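import Summits.Parity.BatemanHorn.Theorems.NormalFamilyBound.Negative.RealAxis

/-!
# `NormalFamilyBound` — negative lemmas III: the disc `|z| < 2` is the natural boundary for `f = (X)`

Support (negative side) for crux `stmt-Parity-9769`
(`Summit.Parity.BatemanHorn.Theses.SelbergDelangeRigidity.NormalFamilyBound`), vocabulary of
`Negative/RealAxis.lean`. For the genuine Bateman–Horn system `f = (X)` and ANY complex `z`, the consecutive
sums `S_{2^m−1}(z)`, `S_{2^m}(z)` differ by `z^{Ω(2^m)} = z^m`, so one of `‖H_{2^m−1}(z)‖`, `‖H_{2^m}(z)‖`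
is at least `(‖z‖/2)^m / (2 (m log 2)^N)` (`exists_norm_H_fX_ge`); hence `sup_x ‖H_x(z)‖ = ∞` whenever
`‖z‖ > 2` (`fX_unbounded_of_two_lt_norm`) and the family is locally bounded on NO set containing such a point
(`fX_not_locallyBoundedOn`). Refuted strengthenings of the crux, all witnessed by `(X)`:

* `normalFamilyBoundRadius_false_of_two_le` — right end `7/4 ↦ R` fails for every `R ≥ 2`: whatever `η > 0`
  the prover picks, the thin rectangle pokes out of the disc at `z₀ = (2 − η²/32) + iη/2` (sharpens the
  real-axis `normalFamilyBoundRadius_false`, `R > 2`, of `Negative/LoadBearing.lean`);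
* `normalFamilyBoundLeft_false_of_two_le` — left end `−η ↦ −R'` fails for every `R' ≥ 2` (mirror point);
* `normalFamilyBoundTall_false` — a fixed height `|Im z| < h`, `h > 1`, fails (`z₀ = 1.74 + i`).

So the crux's thin rectangle STRICTLY inside `|z| < 2` is forced in every direction already by the integers
(Montgomery–Vaughan, Multiplicative Number Theory I, Thm 7.18: the law holds uniformly on `|z| ≤ R < 2` and
"the restriction `R < 2` is necessary"); only the thickness `η` and the corner `7/4` are choices.

Standing disprover's work file: `Summits/Parity/BatemanHorn/Cruxes/NormalFamilyBound/Disproof.lean`.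
-/

namespace Summit.Parity.BatemanHorn.Theorems.NormalFamilyBound.Negative

open Literature.NumberTheory.Sieve Polynomial Finset Filter
open Summit.Parity.BatemanHorn.Theses.SelbergDelangeRigidity
open Summit.Parity.BatemanHorn.Theorems.SystemLSDRealSegment.Negative (isBatemanHornSystem_X)

noncomputable section

/-- The size of the normalising exponential at ANY complex `z`, for `3 ≤ x ≤ 2^m`:
`‖exp(k(1−z) log log x)‖ ≥ (m log 2)^{−N}` whenever `k|1 − Re z| ≤ N`. [folklore] -/
theorem norm_exp_normaliser_ge (k : ℕ) (z : ℂ) {m x N : ℕ} (hm : 2 ≤ m) (hx3 : 3 ≤ x)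
    (hxle : x ≤ 2 ^ m) (hN : k * |1 - z.re| ≤ N) :
    (((m : ℝ) * Real.log 2) ^ N)⁻¹ ≤
      ‖Complex.exp ((k : ℂ) * (1 - z) * (Real.log (Real.log x) : ℂ))‖ := by
  set L : ℝ := Real.log (Real.log x) with hL
  have hre : ((k : ℂ) * (1 - z) * (L : ℂ)).re = k * (1 - z.re) * L := by
    simp [Complex.mul_re, Complex.mul_im]
  rw [Complex.norm_exp, hre]
  have hx3' : (3 : ℝ) ≤ x := by exact_mod_cast hx3
  have hlog3 : (1 : ℝ) < Real.log 3 := by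
    rw [Real.lt_log_iff_exp_lt (by norm_num)]
    have := Real.exp_one_lt_d9
    linarith
  have hlogx : 1 < Real.log x := hlog3.trans_le (Real.log_le_log (by norm_num) hx3')
  have hL0 : 0 ≤ L := Real.log_nonneg hlogx.le
  have ht1 : 1 ≤ (m : ℝ) * Real.log 2 := one_le_mul_log_two hm
  have hlog2m : Real.log x ≤ m * Real.log 2 := by
    have : (x : ℝ) ≤ (2 : ℝ) ^ m := by exact_mod_cast hxle
    calc Real.log x ≤ Real.log ((2 : ℝ) ^ m) := Real.log_le_log (by linarith) this
      _ = m * Real.log 2 := Real.log_pow 2 m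
  have hL1 : L ≤ Real.log (m * Real.log 2) := Real.log_le_log (by linarith) hlog2m
  -- exponent ≥ -N * log (m log 2)
  have hexp : -(N * Real.log (m * Real.log 2)) ≤ k * (1 - z.re) * L := by
    have h1 : -(k * |1 - z.re| * L) ≤ k * (1 - z.re) * L := by
      have := neg_abs_le (1 - z.re)
      have hk : (0 : ℝ) ≤ k := by positivity
      nlinarith [mul_nonneg hk hL0]
    have h2 : k * |1 - z.re| * L ≤ N * Real.log (m * Real.log 2) := by
      have hlog0 : 0 ≤ Real.log (m * Real.log 2) := Real.log_nonneg ht1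
      calc k * |1 - z.re| * L ≤ N * L := by gcongr
        _ ≤ N * Real.log (m * Real.log 2) := by gcongr
    linarith
  calc (((m : ℝ) * Real.log 2) ^ N)⁻¹ = Real.exp (-(N * Real.log (m * Real.log 2))) := by
        rw [Real.exp_neg, Real.exp_nat_mul, Real.exp_log (by linarith)]
    _ ≤ _ := Real.exp_le_exp.mpr hexp

/-- THE JUMP AT `n = 2^m`: for `f = (X)` and ANY complex `z`, the two consecutive sums `S_{2^m−1}(z)`,
`S_{2^m}(z)` differ by `z^{Ω(2^m)} = z^m`, so one of `‖H_{2^m−1}(z)‖`, `‖H_{2^m}(z)‖` is at least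
`(‖z‖/2)^m / (2 (m log 2)^N)` (`N ≥ k|1 − Re z|`). [folklore] -/
theorem exists_norm_H_fX_ge (z : ℂ) {m N : ℕ} (hm : 2 ≤ m) (hN : 1 * |1 - z.re| ≤ N) :
    ∃ x ∈ ({2 ^ m - 1, 2 ^ m} : Finset ℕ),
      (‖z‖ / 2) ^ m / (2 * ((m : ℝ) * Real.log 2) ^ N) ≤ ‖H 1 fX x z‖ := by
  -- the two sums
  set T : ℂ := ∑ n ∈ range (2 ^ m), z ^ (∑ i, ArithmeticFunction.cardFactors (((fX i).eval (n : ℤ)).toNat))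
    with hT
  have h4 : 4 ≤ 2 ^ m := by
    calc 4 = 2 ^ 2 := by norm_num
      _ ≤ 2 ^ m := Nat.pow_le_pow_right (by norm_num) hm
  have hx1 : 2 ^ m - 1 + 1 = 2 ^ m := Nat.sub_add_cancel Nat.one_le_two_pow
  have hS1 : H 1 fX (2 ^ m - 1) z = ((2 ^ m - 1 : ℕ) : ℂ)⁻¹ *
      Complex.exp (((1 : ℕ) : ℂ) * (1 - z) * (Real.log (Real.log (2 ^ m - 1 : ℕ)) : ℂ)) * T := by
    simp only [H, hx1, hT]
  have hterm : (∑ i, ArithmeticFunction.cardFactors (((fX i).eval ((2 ^ m : ℕ) : ℤ)).toNat)) = m := by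
    have := Ωf_fX (2 ^ m)
    simp only [Ωf] at this
    rw [this, ArithmeticFunction.cardFactors_apply_prime_pow Nat.prime_two]
  have hS2 : H 1 fX (2 ^ m) z = ((2 ^ m : ℕ) : ℂ)⁻¹ *
      Complex.exp (((1 : ℕ) : ℂ) * (1 - z) * (Real.log (Real.log (2 ^ m : ℕ)) : ℂ)) * (T + z ^ m) := by
    simp only [H, Finset.sum_range_succ, hterm, hT]
  -- lower bounds for the three factors
  have hpow : (0 : ℝ) < (2 : ℝ) ^ m := by positivity
  have h4' : (4 : ℝ) ≤ (2 : ℝ) ^ m := by exact_mod_cast h4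
  have hinv1 : ((2 : ℝ) ^ m)⁻¹ ≤ ‖((2 ^ m - 1 : ℕ) : ℂ)⁻¹‖ := by
    rw [norm_inv, Complex.norm_natCast]
    refine inv_anti₀ (by rw [Nat.cast_sub Nat.one_le_two_pow]; push_cast; linarith) ?_
    rw [Nat.cast_sub Nat.one_le_two_pow]; push_cast; linarith
  have hinv2 : ((2 : ℝ) ^ m)⁻¹ ≤ ‖((2 ^ m : ℕ) : ℂ)⁻¹‖ := by
    rw [norm_inv, Complex.norm_natCast]; push_cast; exact le_rfl
  have hE1 := norm_exp_normaliser_ge 1 z hm (x := 2 ^ m - 1) (by omega) (Nat.sub_le _ _)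
    (by simpa using hN)
  have hE2 := norm_exp_normaliser_ge 1 z hm (x := 2 ^ m) (by omega) le_rfl (by simpa using hN)
  set c : ℝ := (((m : ℝ) * Real.log 2) ^ N)⁻¹ with hc
  have hc0 : 0 < c := by
    have := one_le_mul_log_two hm
    positivity
  -- triangle inequality: ‖z‖^m ≤ ‖T + z^m‖ + ‖T‖
  have htri : ‖z‖ ^ m ≤ ‖T + z ^ m‖ + ‖T‖ := by
    have := norm_sub_le (T + z ^ m) T
    simpa [norm_pow] using this
  -- combine
  have hsum : 2 * ((‖z‖ / 2) ^ m / (2 * ((m : ℝ) * Real.log 2) ^ N)) ≤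
      ‖H 1 fX (2 ^ m - 1) z‖ + ‖H 1 fX (2 ^ m) z‖ := by
    rw [hS1, hS2, norm_mul, norm_mul, norm_mul, norm_mul]
    calc 2 * ((‖z‖ / 2) ^ m / (2 * ((m : ℝ) * Real.log 2) ^ N))
        = ((2 : ℝ) ^ m)⁻¹ * c * ‖z‖ ^ m := by
          rw [hc, div_pow]; field_simp
      _ ≤ ((2 : ℝ) ^ m)⁻¹ * c * (‖T + z ^ m‖ + ‖T‖) := by gcongr
      _ = ((2 : ℝ) ^ m)⁻¹ * c * ‖T‖ + ((2 : ℝ) ^ m)⁻¹ * c * ‖T + z ^ m‖ := by ring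
      _ ≤ _ := by gcongr
  by_cases h : (‖z‖ / 2) ^ m / (2 * ((m : ℝ) * Real.log 2) ^ N) ≤ ‖H 1 fX (2 ^ m - 1) z‖
  · exact ⟨2 ^ m - 1, by simp, h⟩
  · exact ⟨2 ^ m, by simp, by linarith [not_le.mp h]⟩

/-- NATURAL BOUNDARY for `f = (X)`: at every `z` with `‖z‖ > 2` the sequence `‖H_x(z)‖` is unbounded. [folklore] -/
theorem fX_unbounded_of_two_lt_norm (z : ℂ) (hz : 2 < ‖z‖) : ∀ M : ℝ, ∃ x : ℕ, M < ‖H 1 fX x z‖ := by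
  intro M
  obtain ⟨N, hN⟩ := exists_nat_ge (1 * |1 - z.re|)
  have hq : (1 : ℝ) < ‖z‖ / 2 := by linarith
  have ht : Tendsto (fun m : ℕ => (‖z‖ / 2) ^ m / (2 * ((m : ℝ) * Real.log 2) ^ N)) atTop atTop := by
    have h := (tendsto_geom_div_pow hq N).atTop_div_const
      (by positivity : (0 : ℝ) < 2 * Real.log 2 ^ N)
    refine h.congr' (Eventually.of_forall fun m => ?_)
    simp only [mul_pow]; ring
  obtain ⟨m, hm2, hmM⟩ := ((eventually_ge_atTop 2).and (ht.eventually_gt_atTop M)).exists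
  obtain ⟨x, -, hx⟩ := exists_norm_H_fX_ge z hm2 hN
  exact ⟨x, hmM.trans_le hx⟩

/-- Reduction (set form): a point `z₀ ∈ W` with `sup_x ‖H_x(z₀)‖ = ∞` kills local boundedness on `W`. [folklore] -/
theorem not_locallyBoundedOn_of_unbounded {k : ℕ} {f : Fin k → ℤ[X]} {W : Set ℂ} {z₀ : ℂ}
    (hW : z₀ ∈ W) (h : ∀ M : ℝ, ∃ x : ℕ, M < ‖H k f x z₀‖) :
    ¬ ∀ a ∈ W, ∃ M : ℝ, ∃ r > (0 : ℝ), ∀ x : ℕ, ∀ z ∈ Metric.ball a r ∩ W, ‖H k f x z‖ ≤ M := by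
  intro hB
  obtain ⟨M, r, hr, hM⟩ := hB z₀ hW
  obtain ⟨x, hx⟩ := h M
  have := hM x z₀ ⟨Metric.mem_ball_self hr, hW⟩
  linarith

/-- For `f = (X)`: no set containing a point of modulus `> 2` carries a locally bounded family. [folklore] -/
theorem fX_not_locallyBoundedOn {W : Set ℂ} {z₀ : ℂ} (hz : 2 < ‖z₀‖) (hW : z₀ ∈ W) :
    ¬ ∀ a ∈ W, ∃ M : ℝ, ∃ r > (0 : ℝ), ∀ x : ℕ, ∀ z ∈ Metric.ball a r ∩ W, ‖H 1 fX x z‖ ≤ M :=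
  not_locallyBoundedOn_of_unbounded hW (fX_unbounded_of_two_lt_norm z₀ hz)

/-- HEIGHT: the crux with `|Im z| < η` replaced by a fixed height `h > 1` is false
(f = (X), z₀ = 1.74 + i, `|z₀|² = 4.0276 > 4`). [folklore] -/
theorem normalFamilyBoundTall_false {h : ℝ} (hh : 1 < h) :
    ¬ ∀ (k : ℕ) (f : Fin k → ℤ[X]), IsBatemanHornSystem f →
      ∃ η : ℝ, 0 < η ∧ ∀ a ∈ {z : ℂ | -η < z.re ∧ z.re < 7 / 4 ∧ |z.im| < h},
        ∃ M : ℝ, ∃ r > (0 : ℝ), ∀ x : ℕ,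
          ∀ z ∈ Metric.ball a r ∩ {z : ℂ | -η < z.re ∧ z.re < 7 / 4 ∧ |z.im| < h}, ‖H k f x z‖ ≤ M := by
  intro hyp
  obtain ⟨η, hη, hB⟩ := hyp 1 fX isBatemanHornSystem_X
  refine fX_not_locallyBoundedOn (z₀ := ⟨174 / 100, 1⟩) ?_ ?_ hB
  · have hsq : (2 : ℝ) ^ 2 < ‖(⟨174 / 100, 1⟩ : ℂ)‖ ^ 2 := by
      rw [Complex.sq_norm, Complex.normSq_mk]; norm_num
    exact lt_of_pow_lt_pow_left₀ 2 (norm_nonneg _) hsq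
  · refine ⟨?_, ?_, ?_⟩ <;> simp <;> linarith

/-- RIGHT END, sharp: already `7/4 ↦ 2` fails — the thin rectangle `{−η < Re z < 2, |Im z| < η}` pokes out
of the disc at `z₀ = (2 − η²/32) + iη/2` (`|z₀|² = 4 + η²/8 + η⁴/1024`), whatever `η > 0` the prover picks. [folklore] -/
theorem normalFamilyBoundRadius_false_of_two_le {R : ℝ} (hR : 2 ≤ R) :
    ¬ ∀ (k : ℕ) (f : Fin k → ℤ[X]), IsBatemanHornSystem f →
      ∃ η : ℝ, 0 < η ∧ η ≤ 1 / 4 ∧ ∀ a ∈ {z : ℂ | -η < z.re ∧ z.re < R ∧ |z.im| < η},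
        ∃ M : ℝ, ∃ r > (0 : ℝ), ∀ x : ℕ,
          ∀ z ∈ Metric.ball a r ∩ {z : ℂ | -η < z.re ∧ z.re < R ∧ |z.im| < η}, ‖H k f x z‖ ≤ M := by
  intro h
  obtain ⟨η, hη, hη4, hB⟩ := h 1 fX isBatemanHornSystem_X
  refine fX_not_locallyBoundedOn (z₀ := ⟨2 - η ^ 2 / 32, η / 2⟩) ?_ ?_ hB
  · have hsq : (2 : ℝ) ^ 2 < ‖(⟨2 - η ^ 2 / 32, η / 2⟩ : ℂ)‖ ^ 2 := by
      rw [Complex.sq_norm, Complex.normSq_mk]; nlinarith [sq_nonneg η, pow_pos hη 4]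
    exact lt_of_pow_lt_pow_left₀ 2 (norm_nonneg _) hsq
  · refine ⟨?_, ?_, ?_⟩ <;> simp
    · nlinarith
    · nlinarith
    · rw [abs_of_pos (by linarith)]; linarith

/-- LEFT END, sharp: `−η ↦ −R'` fails for every `R' ≥ 2` (`z₀ = −(2 − η²/32) + iη/2`). [folklore] -/
theorem normalFamilyBoundLeft_false_of_two_le {R' : ℝ} (hR' : 2 ≤ R') :
    ¬ ∀ (k : ℕ) (f : Fin k → ℤ[X]), IsBatemanHornSystem f →
      ∃ η : ℝ, 0 < η ∧ η ≤ 1 / 4 ∧ ∀ a ∈ {z : ℂ | -R' < z.re ∧ z.re < 7 / 4 ∧ |z.im| < η},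
        ∃ M : ℝ, ∃ r > (0 : ℝ), ∀ x : ℕ,
          ∀ z ∈ Metric.ball a r ∩ {z : ℂ | -R' < z.re ∧ z.re < 7 / 4 ∧ |z.im| < η}, ‖H k f x z‖ ≤ M := by
  intro h
  obtain ⟨η, hη, hη4, hB⟩ := h 1 fX isBatemanHornSystem_X
  refine fX_not_locallyBoundedOn (z₀ := ⟨-(2 - η ^ 2 / 32), η / 2⟩) ?_ ?_ hB
  · have hsq : (2 : ℝ) ^ 2 < ‖(⟨-(2 - η ^ 2 / 32), η / 2⟩ : ℂ)‖ ^ 2 := by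
      rw [Complex.sq_norm, Complex.normSq_mk]; nlinarith [sq_nonneg η, pow_pos hη 4]
    exact lt_of_pow_lt_pow_left₀ 2 (norm_nonneg _) hsq
  · refine ⟨?_, ?_, ?_⟩ <;> simp
    · nlinarith
    · nlinarith
    · rw [abs_of_pos (by linarith)]; linarith

end

end Summit.Parity.BatemanHorn.Theorems.NormalFamilyBound.Negative
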